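import Summits.QuantumFields.YangMills.Theorems.BalabanUVNodesPortZDRecordChannel
import Summits.QuantumFields.YangMills.Theorems.BalabanUVNodesPortZDTransportLocality
import Summits.QuantumFields.YangMills.Theorems.BalabanUVNodesPortS1Selector

/-!
# NODE O port, row PT-A′ (PTZ-1, gen 2): the `k = 0` history-channel row of `PortZeroInputSplitZD` (26648, v4Ax-LR4 2e9a851246ef134f) AT THE RECORD
# from TWO DISPLAYED HYPOTHESES OF RECOGNISED SPECIES — the p. 266–267 rider ON THE FIBRES near `W = 1`, and transport determinacy near `W = 1`

[Balaban1987RG1] = [I] (CMP 109, 1987): (0.13) p. 254, (0.17) p. 255, (0.21) p. 256, (1.2) p. 260, (2.9) p. 266 and the rider p. 266–267 («the restrictions on the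
variables at the bonds b₀(c) … with the constant ε₁ replaced by O(ε₁)»); [Balaban1988RG2Cluster] = [II] p. 21.

Seat `ymgap-nodeO-port-PTZ-1` g2 (prover, HELPER MODE; `--supports stmt-QuantumFields-26648 --as helper`; NO `--workitem`).  Companion of this seat's
`…PortZDRecordChannel` (✓p801592: the `k = 0` (L) clause from the GERM hypothesis), `…PortZDTransportLocality` (generic: `𝓝_1 = 𝓝⁰_1` on an open set of coarse
fields from the fibre-wise rider + determinacy, any cut-off over the canonical transport) and PTA-1's `…PortS1Selector` §4 (`continuous_unitField_thetaFill`,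
`unitField_zero`: the chart `B ↦ W_B` is continuous with `W_0 = 1`).

WHAT IS PROVED (0 sorry; no `def` ∕ `instance` ∕ `notation`):
* ★★ `recordGerm_zero_of_fibrewise` — at the record (`θ := thetaFill F a₀ ε₂₉`, transport `TβOfRecord₁₃ = TcanOfRecord`, cut-off `chiβOfRecord₁₃Ax θ`, radius
  `θ.εbg = a₀ > 0`, torus `0 < K`, history `v`): IF (ρ-b₀, fibre-wise) every level-0 field in the support of the record's cut-off whose one-step average lies in an
  open set `U ∋ 1` of coarse fields is regular (`∈ bgReg_0(a₀)`), and (F) `U ⊆ regSetOfRecord K 0 (χ_0 e^{−GF_0∕g_0² + A_0})`, THEN the (L) difference functional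
  VANISHES NEAR `B = 0`: `∀ᶠ B in 𝓝 0, recordΦfAx 0 v K B = recordΦzAx 0 v K B` (the germ hypothesis of `PortZDRecord.formatPlusG_channel_zero_of_germ`).
* ★★ `formatPlusG_channel_zero_of_fibrewise` — hence every format `E ≥ 0` of the difference functional at the record slots (the shifted family `n ↦ K₀ + n`, the
  two hypotheses asked at every member), and ★★ `portZD_histChannel_at_zero_of_fibrewise` — THE `k := 0` INSTANCE OF THE SIGNED (L) CLAUSE (binders verbatim) from
  the two hypotheses asked along every guarded run.
LOCATED (said, not claimed): (ρ-b₀) is print's rider — on the fibre over a regular coarse field the `b₀(c)`-variables are functions of the others through the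
averaging constraint, so the printed cut-off (which leaves them free) still forces regularity THERE; in the tree it is the `bgReg_0` edition of
`Node00.mem_domAltOfRecord_of_chiFix29_eq_one`'s hypothesis `hb0` read fibre-wise (`PortZD.mem_bgReg_zero_of_chiFix29Ax_eq_one`), NOT dischargeable globally;
(F) is node00 K0e's located-open species (F1)–(F3) «how large is `regSet`» (`Node00/CanonicalTransportOfRecord` header; `domAlt_subset_regSetOfRecord` is its
on-domain-proviso form).  Neither is discharged here.

HONEST FRAMING.  Definition chasing + the two companions; NOTHING of Bałaban's estimates asserted, ported or discharged; 26648 ∕ 27930⁸ SIGNED·OPEN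
(content-gated: (Z) = Thm 3's step at zero input, (L) = [II] Lemma 3), 27931 under CLOSE HOLD, 27932 CLOSED; K0⁷ ∕ K-Ax OPEN; counts unmoved; finite 𝕋⁴ at fixed
ε — NOT continuum ∕ OS ∕ Clay; the Yang–Mills mass gap is NOT proved by any of this.
-/

noncomputable section

namespace Summit.QuantumFields.YangMills.Theorems.PortZDRecord

open scoped Topology
open Filter Set
open Literature.MathematicalPhysics.QuantumFieldTheory.Balaban1983to89
open Literature.MathematicalPhysics.QuantumFieldTheory.Balaban1983to89.Node00
open Literature.MathematicalPhysics.QuantumFieldTheory.Balaban1983to89.T4Continuum (T4Family)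
open Literature.MathematicalPhysics.QuantumFieldTheory.Balaban1983to89.B12FormatPlus (FormatPlusG)
open Summit.QuantumFields.YangMills.Theorems.K0RecordFormatNames
open B12Eq019ActionBody (integrand)

variable (F : T4Family) (a₀ ε₂₉ : ℝ)

/-- ★★ **THE GERM AT THE RECORD FROM THE FIBRE-WISE RIDER AND DETERMINACY NEAR `W = 1`**: with `θ := thetaFill F a₀ ε₂₉` (`θ.εbg = a₀`), `0 < a₀`, `0 < K`, a
history `v : Fin 1 → ℝ` and an OPEN set `U ∋ 1` of level-1 fields such that (ρ-b₀) `∀ V, V̄ ∈ U → χ^{(2.9)}_{0,ax}(V) ≠ 0 → V ∈ bgReg_0(a₀)` and (F)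
`U ⊆ regSetOfRecord K 0 (χ_0 e^{−GF_0∕g_0² + A_0})` (`g_0 = extd v 0`), the (L) difference functional vanishes near `B = 0`:
`∀ᶠ B in 𝓝 0, recordΦfAx 0 v K B = recordΦzAx 0 v K B` (the chart `B ↦ W_B` is continuous with `W_0 = 1 ∈ U`; on `{B | W_B ∈ U}` apply
`PortZD.dChannel_zero_at_first_level_fibrewise`). [cite: Balaban1987RG1, (0.17) p.255, (0.21) p.256, (2.9) p.266–267, (0.13) p.254] -/
theorem recordGerm_zero_of_fibrewise (ha₀ : 0 < a₀) {K : ℕ} (hK : 0 < K) (v : Fin 1 → ℝ) {U : Set (PBond (F.P K) 1 → SU 2)}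
    (hUo : IsOpen U) (h1 : (1 : GaugeField (F.P K) 1 (SU 2)) ∈ U)
    (hχU : ∀ V : GaugeField (F.P K) 0 (SU 2), (avOfRecord F 2 K 0).avg V ∈ U →
      chiβOfRecord₁₃Ax F 2 (thetaFill F a₀ ε₂₉) K (T4FlagMemory.extd v) 0 V ≠ 0 → V ∈ bgReg F 2 K 0 a₀)
    (hreg : U ⊆ regSetOfRecord F 2 K 0
      (integrand (chiβOfRecord₁₃Ax F 2 (thetaFill F a₀ ε₂₉) K (T4FlagMemory.extd v) 0) (gfOfRecord F 2 K 0) (T4FlagMemory.extd v 0)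
        (effActionHT F 2 (TβOfRecord₁₃ F 2) (chiβOfRecord₁₃Ax F 2 (thetaFill F a₀ ε₂₉)) K (T4FlagMemory.extd v) 0))) :
    letI θ := thetaFill F a₀ ε₂₉
    letI := θ.instVβ₁; letI := θ.instVβ₂
    ∀ᶠ B in 𝓝 (0 : recordW F a₀ ε₂₉ 0 K), recordΦfAx F a₀ ε₂₉ 0 v K B = recordΦzAx F a₀ ε₂₉ 0 v K B := by
  letI θ := thetaFill F a₀ ε₂₉
  letI := θ.instVβ₁; letI := θ.instVβ₂
  have hcont := BalabanUVNodesPortS1.continuous_unitField_thetaFill F a₀ ε₂₉ 0 K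
  have h0 : unitField F θ 0 K (0 : recordW F a₀ ε₂₉ 0 K) ∈ U := by
    rw [BalabanUVNodesPortS1.unitField_zero F θ 0 K]
    exact h1
  have hev : ∀ᶠ B in 𝓝 (0 : recordW F a₀ ε₂₉ 0 K), unitField F θ 0 K B ∈ U :=
    hcont.continuousAt.preimage_mem_nhds (hUo.mem_nhds h0)
  filter_upwards [hev] with B hB
  rw [← sub_eq_zero, recordΦfAx_sub_recordΦzAx, Complex.ofReal_eq_zero, sub_eq_zero]
  exact PortZD.dChannel_zero_at_first_level_fibrewise (N := 2) (chiβOfRecord₁₃Ax F 2 θ) ha₀ hK (T4FlagMemory.extd v) hUo hχU hreg h1 hB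

/-- ★★ **EVERY FORMAT `E ≥ 0` OF THE DIFFERENCE FUNCTIONAL AT THE RECORD SLOTS, `k = 0`, FROM THE TWO DISPLAYED HYPOTHESES** asked at every member of the shifted
family `n ↦ K₀ + n` (an open set `U n ∋ 1` of level-1 fields on `T_{K₀+n}` with the fibre-wise rider and determinacy), `0 < a₀`, `0 < K₀`.
[cite: Balaban1987RG1, (0.17) p.255, (1.18)–(1.19) p.263, (2.9) p.266–267; Balaban1988RG2Cluster, p.21] -/
theorem formatPlusG_channel_zero_of_fibrewise (ha₀ : 0 < a₀) (Mc K₀ : ℕ) (hK₀ : 0 < K₀) (α₀ α₁ κ E : ℝ) (hE : 0 ≤ E) (v : Fin 1 → ℝ)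
    (U : (n : ℕ) → Set (PBond (F.P (K₀ + n)) 1 → SU 2)) (hUo : ∀ n, IsOpen (U n))
    (h1 : ∀ n, (1 : GaugeField (F.P (K₀ + n)) 1 (SU 2)) ∈ U n)
    (hχU : ∀ n (V : GaugeField (F.P (K₀ + n)) 0 (SU 2)), (avOfRecord F 2 (K₀ + n) 0).avg V ∈ U n →
      chiβOfRecord₁₃Ax F 2 (thetaFill F a₀ ε₂₉) (K₀ + n) (T4FlagMemory.extd v) 0 V ≠ 0 → V ∈ bgReg F 2 (K₀ + n) 0 a₀)
    (hreg : ∀ n, U n ⊆ regSetOfRecord F 2 (K₀ + n) 0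
      (integrand (chiβOfRecord₁₃Ax F 2 (thetaFill F a₀ ε₂₉) (K₀ + n) (T4FlagMemory.extd v) 0) (gfOfRecord F 2 (K₀ + n) 0)
        (T4FlagMemory.extd v 0) (effActionHT F 2 (TβOfRecord₁₃ F 2) (chiβOfRecord₁₃Ax F 2 (thetaFill F a₀ ε₂₉)) (K₀ + n) (T4FlagMemory.extd v) 0))) :
    letI θ := thetaFill F a₀ ε₂₉
    letI := θ.instVβ₁; letI := θ.instVβ₂; letI := θ.instιβ
    FormatPlusG (fun n => recordDomSys F Mc 0 (K₀ + n)) (fun n => recordBondCount F (K₀ + n)) (fun n => recordAct F (K₀ + n))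
      (fun n => recordUc F Mc 0 α₀ α₁ (K₀ + n)) (fun n => recordCoords F Mc 0 (K₀ + n)) (fun n => recordChartDimJ F (K₀ + n))
      (fun n => recordChartJ F Mc 0 (K₀ + n))
      (fun n B => recordΦfAx F a₀ ε₂₉ 0 v (K₀ + n) B - recordΦzAx F a₀ ε₂₉ 0 v (K₀ + n) B)
      (fun n => recordEmbJ F θ 0 (K₀ + n)) (fun n => recordWrapCtr F Mc 0 (K₀ + n)) (fun n => recordDomEmbCtr F Mc 0 (K₀ + n))
      (fun n _ => recordCoordProjCtr F (K₀ + n)) E κ :=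
  formatPlusG_channel_zero_of_germ F a₀ ε₂₉ Mc K₀ α₀ α₁ κ E hE v fun n =>
    recordGerm_zero_of_fibrewise F a₀ ε₂₉ ha₀ (Nat.add_pos_left hK₀ n) v (hUo n) (h1 n) (hχU n) (hreg n)

/-- ★★ **THE `k := 0` INSTANCE OF THE SIGNED (L) CLAUSE OF `PortZeroInputSplitZD` FROM THE TWO DISPLAYED HYPOTHESES** along every guarded run (binders and slots
verbatim with `k := 0`; `recordK₀ F Mc 0 > 0` displayed as `hK₀`; `0 ≤ ρ`).  The cut-off being coupling-blind, (ρ-b₀) does not depend on the run; (F) is asked at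
the run's level-0 density. [cite: Balaban1987RG1, (0.17) p.255, (0.20) p.256, (1.18)–(1.19) p.263, (2.9) p.266–267; Balaban1988RG2Cluster, p.21] -/
theorem portZD_histChannel_at_zero_of_fibrewise (ha₀ : 0 < a₀) (Mc : ℕ) (hK₀ : 0 < recordK₀ F Mc 0) (β : FlowStep.HBeta)
    (γ₀ ρ Ē κ α₀ α₁ : ℝ) (hρ : 0 ≤ ρ)
    (U : (n : ℕ) → Set (PBond (F.P (recordK₀ F Mc 0 + n)) 1 → SU 2)) (hUo : ∀ n, IsOpen (U n))
    (h1 : ∀ n, (1 : GaugeField (F.P (recordK₀ F Mc 0 + n)) 1 (SU 2)) ∈ U n)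
    (hχU : ∀ n (g : ℕ → ℝ) (V : GaugeField (F.P (recordK₀ F Mc 0 + n)) 0 (SU 2)), (avOfRecord F 2 (recordK₀ F Mc 0 + n) 0).avg V ∈ U n →
      chiβOfRecord₁₃Ax F 2 (thetaFill F a₀ ε₂₉) (recordK₀ F Mc 0 + n) g 0 V ≠ 0 → V ∈ bgReg F 2 (recordK₀ F Mc 0 + n) 0 a₀)
    (hreg : ∀ g : ℕ → ℝ, FlowStep.RGEqH 0 β g → Step.InInterval γ₀ 0 g → ∀ n, U n ⊆ regSetOfRecord F 2 (recordK₀ F Mc 0 + n) 0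
      (integrand (chiβOfRecord₁₃Ax F 2 (thetaFill F a₀ ε₂₉) (recordK₀ F Mc 0 + n) (T4FlagMemory.extd (FlowStep.prefixOf g 0)) 0)
        (gfOfRecord F 2 (recordK₀ F Mc 0 + n) 0) (T4FlagMemory.extd (FlowStep.prefixOf g 0) 0)
        (effActionHT F 2 (TβOfRecord₁₃ F 2) (chiβOfRecord₁₃Ax F 2 (thetaFill F a₀ ε₂₉)) (recordK₀ F Mc 0 + n)
          (T4FlagMemory.extd (FlowStep.prefixOf g 0)) 0))) :
    ∀ g : ℕ → ℝ, FlowStep.RGEqH 0 β g → Step.InInterval γ₀ 0 g → ∀ E : ℝ, 0 < E → E ≤ Ē →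
      (∀ k₁ : ℕ, k₁ < 0 →
        letI θ := thetaFill F a₀ ε₂₉
        letI := θ.instVβ₁; letI := θ.instVβ₂; letI := θ.instιβ
        FormatPlusG (fun n => recordDomSys F Mc k₁ (recordK₀ F Mc k₁ + n)) (fun n => recordBondCount F (recordK₀ F Mc k₁ + n))
          (fun n => recordAct F (recordK₀ F Mc k₁ + n)) (fun n => recordUc F Mc k₁ α₀ α₁ (recordK₀ F Mc k₁ + n))
          (fun n => recordCoords F Mc k₁ (recordK₀ F Mc k₁ + n)) (fun n => recordChartDimJ F (recordK₀ F Mc k₁ + n))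
          (fun n => recordChartJ F Mc k₁ (recordK₀ F Mc k₁ + n))
          (fun n => recordΦfAx F a₀ ε₂₉ k₁ (FlowStep.prefixOf g k₁) (recordK₀ F Mc k₁ + n))
          (fun n => recordEmbJ F θ k₁ (recordK₀ F Mc k₁ + n)) (fun n => recordWrapCtr F Mc k₁ (recordK₀ F Mc k₁ + n))
          (fun n => recordDomEmbCtr F Mc k₁ (recordK₀ F Mc k₁ + n)) (fun n _ => recordCoordProjCtr F (recordK₀ F Mc k₁ + n)) E κ) →
      letI θ := thetaFill F a₀ ε₂₉
      letI := θ.instVβ₁; letI := θ.instVβ₂; letI := θ.instιβ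
      FormatPlusG (fun n => recordDomSys F Mc 0 (recordK₀ F Mc 0 + n)) (fun n => recordBondCount F (recordK₀ F Mc 0 + n))
        (fun n => recordAct F (recordK₀ F Mc 0 + n)) (fun n => recordUc F Mc 0 α₀ α₁ (recordK₀ F Mc 0 + n))
        (fun n => recordCoords F Mc 0 (recordK₀ F Mc 0 + n)) (fun n => recordChartDimJ F (recordK₀ F Mc 0 + n))
        (fun n => recordChartJ F Mc 0 (recordK₀ F Mc 0 + n))
        (fun n B => recordΦfAx F a₀ ε₂₉ 0 (FlowStep.prefixOf g 0) (recordK₀ F Mc 0 + n) B -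
          recordΦzAx F a₀ ε₂₉ 0 (FlowStep.prefixOf g 0) (recordK₀ F Mc 0 + n) B)
        (fun n => recordEmbJ F θ 0 (recordK₀ F Mc 0 + n)) (fun n => recordWrapCtr F Mc 0 (recordK₀ F Mc 0 + n))
        (fun n => recordDomEmbCtr F Mc 0 (recordK₀ F Mc 0 + n)) (fun n _ => recordCoordProjCtr F (recordK₀ F Mc 0 + n)) (ρ * E) κ :=
  portZD_histChannel_at_zero_of_germ F a₀ ε₂₉ Mc β γ₀ ρ Ē κ α₀ α₁ hρ fun g hfl hin n =>
    recordGerm_zero_of_fibrewise F a₀ ε₂₉ ha₀ (Nat.add_pos_left hK₀ n) (FlowStep.prefixOf g 0) (hUo n) (h1 n)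
      (hχU n (T4FlagMemory.extd (FlowStep.prefixOf g 0))) (hreg g hfl hin n)

end Summit.QuantumFields.YangMills.Theorems.PortZDRecord

end
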